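import Summits.RiemannHypothesis.RiemannHypothesis.Theorems.OddSectorOddOneSignedWindowsFormDomainGroundState
import Summits.RiemannHypothesis.RiemannHypothesis.Theorems.OddSectorOddOneSignedWindowsFiniteEnergy
import Summits.RiemannHypothesis.RiemannHypothesis.Theorems.OddSectorOddArchAnchor
import Literature.NumberTheory.LFunctions.WeilOddThetaVector
import HarnessLib

/-!
# The fold criterion: an odd ground state without sign-opposed reflected pairs certifies a good
# window (helper for crux `OddSector.OddOneSignedWindows`, item stmt-RiemannHypothesis-17778; RH-free)

The antisymmetric Beurling–Deny folding that proves `OddArchAnchor` (archimedean form) and the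
small-window theorem (full form below the first prime) controls every term of
`Re Q = P + 𝓔_a − M_a‖·‖²` EXCEPT the reflected prime pairs `s + s' = log n` inside `(0, a)`: for a
real odd `u` and its fold `v = sign·|u|`, `D_{log n}(v) − D_{log n}(u) = 4∫(u(s)u(log n − s))⁻ ds`
over those pairs, while the pole form, the archimedean energy and the same-side prime pairs do not
increase (crux strategy census, T1; 2001 programme, "variational negativity criterion"). This file
proves the resulting RH-free FOLD CRITERION (`goodWindow_of_noOpposedReflections`): if a real
odd-sector ground state `u` at the window `a` has NO SIGN-OPPOSED REFLECTED PAIR — for every prime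
length `log n < 2a`, `u(s)·u(log n − s) ≥ 0` for a.e. `s` with `s, log n − s ∈ (0, a)` — then the
window `a` is good: `sign·|u|` is an odd-sector ground state, real and `≥ 0` on `(0, ∞)`. With the
strategist's kernel-checked `residue_iff` (crux dir, `StrategistSketch.lean`) this makes
`NoOpposedReflections ↔ OddOneSignedWindows` unconditional: the crux IS the existence, beyond every
height, of a real odd ground state without sign-opposed reflected pairs.

## Proof

Work in the form domain (`isWeilOddGroundState_of_energy_le`): replace `u` by a measurable,
everywhere odd, real representative living on `[-a, a]` (`exists_oddRepr`), put `v = sign·|u|`, and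
compare `P(v) + 𝓔_a(v)` with `P(u) + 𝓔_a(u) ≤ M_a + ε_od(a)` (`IsWeilOddGroundState.finiteEnergy`):
the pole form folds (`|∫ u sinh(t/2)| ≤ ∫|u||sinh(t/2)| = |∫ v sinh(t/2)|`), the archimedean energy
folds (`lintegral_arch_fold_le`, the folded-kernel inequality of `OddArchAnchor`, for measurable
odd functions), and each prime increment folds under the hypothesis
(`weilIncrement_signFold_le`: pointwise `||A| − |B|| ≤ |A − B|` on same-side pairs and
`|A| + |B| = |A + B|` on reflected pairs of the same sign).

References: 2001 programme, route `odd-sector-eigenfunction-sign` (ATTEMPTS 2026-08-10, Rem 11.20(3));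
R. Bañuelos, T. Kulczycki, J. Funct. Anal. 211 (2004) Thm 4.3; E. Bombieri, Rend. Mat. Acc. Lincei
(9) 11 (2000), §4.
-/

noncomputable section

set_option linter.dupNamespace false

open MeasureTheory Set Filter
open scoped Topology ENNReal ArithmeticFunction.vonMangoldt

namespace Summit.RiemannHypothesis.RiemannHypothesis.Theorems.OddSector

open Literature.NumberTheory.LFunctions Literature.NumberTheory.LFunctions.ConnesVanSuijlekom
open Summit.RiemannHypothesis.RiemannHypothesis.Theorems.WeilGroundStateMarkovPart
open Summit.RiemannHypothesis.RiemannHypothesis.Theorems.OddArchAnchor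

/-! ### A measurable, everywhere odd, real representative living on the window -/

/-- **Good representatives of a real odd-sector ground state.** A real odd-sector ground state `u`
at the window `a` agrees a.e. with a MEASURABLE function `w` which is odd EVERYWHERE, real everywhere
and vanishes everywhere off `[-a, a]` (symmetrise a measurable modification and cut it off to the
window; `u` is odd a.e. and vanishes a.e. off the window). [folklore] -/
theorem exists_oddRepr {a : ℝ} {u : ℝ → ℂ} (hu : IsWeilOddGroundState a u) (hreal : ∀ t, (u t).im = 0) :
    ∃ w : ℝ → ℂ, Measurable w ∧ (∀ x, w (-x) = -w x) ∧ (∀ x, x ∉ Icc (-a) a → w x = 0) ∧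
      (∀ x, (w x).im = 0) ∧ w =ᵐ[volume] u := by
  set m : ℝ → ℂ := hu.memLp.1.aemeasurable.mk u with hm
  have hmm : Measurable m := hu.memLp.1.aemeasurable.measurable_mk
  have hmu : u =ᵐ[volume] m := hu.memLp.1.aemeasurable.ae_eq_mk
  set w : ℝ → ℂ := (Icc (-a) a).indicator fun x ↦ ((((m x).re - (m (-x)).re) / 2 : ℝ) : ℂ) with hw
  have hwin : ∀ x, x ∈ Icc (-a) a → w x = ((((m x).re - (m (-x)).re) / 2 : ℝ) : ℂ) := fun x hx ↦
    indicator_of_mem hx _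
  have hwout : ∀ x, x ∉ Icc (-a) a → w x = 0 := fun x hx ↦ indicator_of_notMem hx _
  refine ⟨w, ?_, ?_, hwout, ?_, ?_⟩
  · have h1 : Measurable fun x ↦ ((((m x).re - (m (-x)).re) / 2 : ℝ) : ℂ) :=
      Complex.measurable_ofReal.comp (((Complex.measurable_re.comp hmm).sub
        (Complex.measurable_re.comp (hmm.comp measurable_neg))).div_const 2)
    exact h1.indicator measurableSet_Icc
  · intro x
    by_cases hx : x ∈ Icc (-a) a
    · rw [hwin x hx, hwin (-x) (neg_mem_Icc_neg_iff.2 hx), neg_neg, ← Complex.ofReal_neg]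
      congr 1; ring
    · rw [hwout x hx, hwout (-x) (mt neg_mem_Icc_neg_iff.1 hx), neg_zero]
  · intro x
    by_cases hx : x ∈ Icc (-a) a
    · rw [hwin x hx, Complex.ofReal_im]
    · rw [hwout x hx, Complex.zero_im]
  · have hneg : ∀ᵐ x : ℝ, u (-x) = m (-x) :=
      (Measure.measurePreserving_neg (volume : Measure ℝ)).quasiMeasurePreserving.tendsto_ae.eventually
        hmu
    filter_upwards [hmu, hneg, hu.ae_neg, hu.ae_eq_zero_of_notMem] with x h1 h2 h3 h4
    by_cases hx : x ∈ Icc (-a) a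
    · rw [hwin x hx, ← h1, ← h2, h3, Complex.neg_re]
      apply Complex.ext
      · simp only [Complex.ofReal_re]; ring
      · simp only [Complex.ofReal_im, hreal x]
    · rw [hwout x hx, h4 hx]

/-! ### The sign fold of a window function and its energy -/

section Fold

variable {a : ℝ} {w : ℝ → ℂ}

/-- The sign fold `x ↦ sign(x)·|w(x)|` is measurable. [folklore] -/
theorem measurable_signFold (hwm : Measurable w) :
    Measurable fun x : ℝ ↦ (((Real.sign x * ‖w x‖ : ℝ)) : ℂ) :=
  Complex.measurable_ofReal.comp
    (Literature.Analysis.FunctionSpaces.BMOInv.measurable_real_sign.mul hwm.norm)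

/-- The sign fold of an everywhere odd function is odd. [folklore] -/
theorem signFold_neg (hwo : ∀ x, w (-x) = -w x) (x : ℝ) :
    (((Real.sign (-x) * ‖w (-x)‖ : ℝ)) : ℂ) = -(((Real.sign x * ‖w x‖ : ℝ)) : ℂ) := by
  rw [Real.sign_neg, hwo, norm_neg, ← Complex.ofReal_neg]
  congr 1; ring

/-- **Prime increments fold when the reflected pairs are not sign-opposed.** Let `w` be real, odd,
vanishing off `[-a, a]`, in `L²`, and let `t > 0` be a length such that `w(y)·w(t − y) ≥ 0` for
a.e. `y` with `y, t − y ∈ (0, a)`. Then `D_t(sign·|w|) ≤ D_t(w)`: on same-side pairs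
`||A| − |B|| ≤ |A − B|`, and on the reflected pairs `x ∈ (−t, 0)` the increment of the fold is
`|w(x+t)| + |w(−x)| = |w(x+t) + w(−x)| = |w(x+t) − w(x)|` because the two real numbers have the
same sign (or one vanishes, outside the window). [folklore] -/
theorem weilIncrement_signFold_le (hw2 : MemLp w 2) (hwo : ∀ x, w (-x) = -w x)
    (hws : ∀ x, x ∉ Icc (-a) a → w x = 0) (hreal : ∀ x, (w x).im = 0) {t : ℝ} (ht : 0 < t)
    (hpairs : ∀ᵐ y : ℝ, y ∈ Ioo 0 a → t - y ∈ Ioo 0 a → 0 ≤ (w y).re * (w (t - y)).re) :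
    weilIncrement (fun x ↦ (((Real.sign x * ‖w x‖ : ℝ)) : ℂ)) t ≤ weilIncrement w t := by
  set v : ℝ → ℂ := fun x ↦ (((Real.sign x * ‖w x‖ : ℝ)) : ℂ) with hv
  have hvm : MemLp v 2 := memLp_signFold hw2
  -- same-side contraction
  have hpos : ∀ x s, 0 < x → 0 < s → ‖v s - v x‖ ≤ ‖w s - w x‖ := fun x s hx hs ↦ by
    simp only [hv, Real.sign_of_pos hx, Real.sign_of_pos hs, one_mul, ← Complex.ofReal_sub,
      Complex.norm_real, Real.norm_eq_abs]
    exact abs_norm_sub_norm_le _ _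
  have hvo : ∀ x, v (-x) = -v x := signFold_neg hwo
  -- the real values
  have hwre : ∀ x, w x = ((w x).re : ℂ) := fun x ↦ Complex.ext rfl (by simp [hreal x])
  have hnorm : ∀ x, ‖w x‖ = |(w x).re| := fun x ↦ by
    rw [hwre x, Complex.norm_real, Real.norm_eq_abs, Complex.ofReal_re]
  -- transport the pair hypothesis to `x = -y`
  have hpairs' : ∀ᵐ x : ℝ, -x ∈ Ioo 0 a → t - -x ∈ Ioo 0 a → 0 ≤ (w (-x)).re * (w (t - -x)).re :=
    (Measure.measurePreserving_neg (volume : Measure ℝ)).quasiMeasurePreserving.tendsto_ae.eventually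
      hpairs
  -- the a.e. pointwise comparison
  have hae : ∀ᵐ x : ℝ, ‖v (x + t) - v x‖ ^ 2 ≤ ‖w (x + t) - w x‖ ^ 2 := by
    filter_upwards [hpairs', Measure.ae_ne volume 0, Measure.ae_ne volume (-t),
      Measure.ae_ne volume (-a), Measure.ae_ne volume (a - t)] with x hx h0 ht' ha' hat
    refine pow_le_pow_left₀ (norm_nonneg _) ?_ 2
    rcases lt_or_gt_of_ne h0 with hx0 | hx0
    · rcases lt_or_gt_of_ne ht' with hxt | hxt
      · -- `x < -t`: both points negative; reflect to the positive side
        have h1 : ‖v (x + t) - v x‖ = ‖v (-x) - v (-(x + t))‖ := by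
          rw [hvo, hvo, show -v x - -v (x + t) = v (x + t) - v x by ring]
        have h2 : ‖w (x + t) - w x‖ = ‖w (-x) - w (-(x + t))‖ := by
          rw [hwo, hwo, show -w x - -w (x + t) = w (x + t) - w x by ring]
        rw [h1, h2]
        exact hpos _ _ (by linarith) (by linarith)
      · -- `-t < x < 0`: a reflected pair `(x + t, -x)`
        have hxt0 : 0 < x + t := by linarith
        have e1 : v (x + t) - v x = (((‖w (x + t)‖ + ‖w x‖ : ℝ)) : ℂ) := by
          simp only [hv, Real.sign_of_pos hxt0, Real.sign_of_neg hx0, one_mul, neg_one_mul,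
            ← Complex.ofReal_sub, sub_neg_eq_add]
        set A := (w (x + t)).re with hAdef
        set B := (w x).re with hBdef
        have e3 : ‖w (x + t) - w x‖ = |A - B| := by
          rw [hwre (x + t), hwre x, ← Complex.ofReal_sub, Complex.norm_real, Real.norm_eq_abs]
        rw [e1, Complex.norm_real, Real.norm_of_nonneg (by positivity), hnorm, hnorm, e3]
        show |A| + |B| ≤ |A - B|
        -- `A = (w(x+t)).re` and `-B = (w(-x)).re` have the same sign (or one is `0`)
        have hsame : 0 ≤ A * (-B) := by
          have e2 : -B = (w (-x)).re := by rw [hBdef, hwo, Complex.neg_re]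
          rw [e2]
          by_cases hy : -x ∈ Ioo 0 a
          · by_cases hy' : t - -x ∈ Ioo 0 a
            · have := hx hy hy'
              rw [show t - -x = x + t by ring] at this
              rw [mul_comm]
              exact this
            · -- `x + t ∉ (0, a)`, `x + t > 0`, `x + t ≠ a`: outside the window
              have hout : x + t ∉ Icc (-a) a := fun hm ↦ by
                rw [show t - -x = x + t by ring] at hy'
                exact hy' ⟨hxt0, lt_of_le_of_ne hm.2 (fun h ↦ hat (by linarith))⟩
              rw [hAdef, hws _ hout, Complex.zero_re, zero_mul]
          · -- `-x ∉ (0, a)`, `-x > 0`, `-x ≠ a`: outside the window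
            have hout : -x ∉ Icc (-a) a := fun hm ↦
              hy ⟨by linarith, lt_of_le_of_ne hm.2 (fun h ↦ ha' (by linarith))⟩
            rw [hws _ hout, Complex.zero_re, mul_zero]
        -- `|A| + |B| ≤ |A − B|` when `A·(−B) ≥ 0`
        rcases le_total 0 A with hA | hA <;> rcases le_total 0 B with hB | hB
        · have : A * B = 0 := by nlinarith
          rcases mul_eq_zero.1 this with h | h
          · rw [h]; simp
          · rw [h]; simp
        · rw [abs_of_nonneg hA, abs_of_nonpos hB, abs_of_nonneg (by linarith)]; linarith
        · rw [abs_of_nonpos hA, abs_of_nonneg hB, abs_of_nonpos (by linarith)]; linarith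
        · have : A * B = 0 := by nlinarith
          rcases mul_eq_zero.1 this with h | h
          · rw [h]; simp
          · rw [h]; simp
    · exact hpos _ _ hx0 (by linarith)
  unfold weilIncrement
  exact integral_mono_ae (integrable_weilIncrement_integrand hvm t)
    (integrable_weilIncrement_integrand hw2 t) hae

/-- **The archimedean energy folds, form-domain version.** For `w` measurable, odd, vanishing off
`[-a, a]`, in `L²`, with integrable archimedean energy density, the fold `v = sign·|w|` has
integrable archimedean energy density and `∫₀^∞ ρ D(v) ≤ ∫₀^∞ ρ D(w)` (the folded-kernel
inequality `lintegral_arch_fold_le` of `OddArchAnchor`, converted to Bochner integrals).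
[folklore] -/
theorem archEnergy_signFold_le (hwm : Measurable w) (hw2 : MemLp w 2) (hwo : ∀ x, w (-x) = -w x)
    (hws : ∀ x, x ∉ Icc (-a) a → w x = 0)
    (hE : IntegrableOn (fun t ↦ weilArchDensity t * weilIncrement w t) (Ioi 0)) :
    IntegrableOn (fun t ↦ weilArchDensity t *
        weilIncrement (fun x ↦ (((Real.sign x * ‖w x‖ : ℝ)) : ℂ)) t) (Ioi 0) ∧
      ∫ t in Ioi (0 : ℝ), weilArchDensity t * weilIncrement (fun x ↦ (((Real.sign x * ‖w x‖ : ℝ)) : ℂ)) t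
        ≤ ∫ t in Ioi (0 : ℝ), weilArchDensity t * weilIncrement w t := by
  set v : ℝ → ℂ := fun x ↦ (((Real.sign x * ‖w x‖ : ℝ)) : ℂ) with hv
  have hvm : Measurable v := measurable_signFold hwm
  have hv2 : MemLp v 2 := memLp_signFold hw2
  have hvo : ∀ x, v (-x) = -v x := signFold_neg hwo
  have hvs : ∀ x, x ∉ Icc (-a) a → v x = 0 := fun x hx ↦ by
    simp only [hv, hws x hx, norm_zero, mul_zero, Complex.ofReal_zero]
  have hd : ∀ x s, 0 < x → 0 < s → ‖v s - v x‖ ≤ ‖w s - w x‖ := fun x s hx hs ↦ by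
    simp only [hv, Real.sign_of_pos hx, Real.sign_of_pos hs, one_mul, ← Complex.ofReal_sub,
      Complex.norm_real, Real.norm_eq_abs]
    exact abs_norm_sub_norm_le _ _
  have hn : ∀ x, 0 < x → ‖v x‖ ≤ ‖w x‖ := fun x hx ↦ by
    simp only [hv, Real.sign_of_pos hx, one_mul, Complex.norm_real, norm_norm, le_refl]
  have hfold := lintegral_arch_fold_le hwm hvm hwo hvo hd hn
  -- conversions between `lintegral` and Bochner integrals
  have hDv : Continuous (weilIncrement v) := continuous_weilIncrement_of_memLp hv2 hvs hvo
  have hinner : ∀ (f : ℝ → ℂ), MemLp f 2 → ∀ t, ∫⁻ x, ENNReal.ofReal (‖f (x + t) - f x‖ ^ 2) =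
      ENNReal.ofReal (weilIncrement f t) := fun f hf t ↦ by
    rw [weilIncrement, ofReal_integral_eq_lintegral_ofReal (integrable_weilIncrement_integrand hf t)
      (Eventually.of_forall fun x ↦ by positivity)]
  have hnn : ∀ f : ℝ → ℂ, 0 ≤ᵐ[volume.restrict (Ioi 0)] fun t ↦ weilArchDensity t * weilIncrement f t :=
    fun f ↦ (ae_restrict_iff' measurableSet_Ioi).2 (Eventually.of_forall fun t ht ↦
      mul_nonneg (weilArchDensity_pos ht).le (weilIncrement_nonneg f t))
  have hL : ∀ (f : ℝ → ℂ), MemLp f 2 → (∫⁻ t in Ioi (0 : ℝ), ENNReal.ofReal (weilArchDensity t) *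
      ∫⁻ x, ENNReal.ofReal (‖f (x + t) - f x‖ ^ 2)) =
      ∫⁻ t in Ioi (0 : ℝ), ENNReal.ofReal (weilArchDensity t * weilIncrement f t) := fun f hf ↦ by
    refine setLIntegral_congr_fun measurableSet_Ioi fun t ht ↦ ?_
    rw [hinner f hf t, ← ENNReal.ofReal_mul (weilArchDensity_pos ht).le]
  rw [hL v hv2, hL w hw2, ← ofReal_integral_eq_lintegral_ofReal hE (hnn w)] at hfold
  have hvmeas : AEStronglyMeasurable (fun t ↦ weilArchDensity t * weilIncrement v t)
      (volume.restrict (Ioi 0)) :=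
    (measurable_weilArchDensity.mul hDv.measurable).aestronglyMeasurable
  have hint : IntegrableOn (fun t ↦ weilArchDensity t * weilIncrement v t) (Ioi 0) :=
    ⟨hvmeas, (hasFiniteIntegral_iff_ofReal (hnn v)).2 (hfold.trans_lt ENNReal.ofReal_lt_top)⟩
  refine ⟨hint, ?_⟩
  rw [integral_eq_lintegral_of_nonneg_ae (hnn v) hvmeas]
  exact ENNReal.toReal_le_of_le_ofReal (integral_nonneg_of_ae (hnn w)) hfold

/-- **The pole form folds**: for an everywhere odd real `w`, `P(sign·|w|) ≤ P(w)`
(`P = −2|∫ · sinh(t/2)|²` on odd functions and `|∫ w sinh(t/2)| ≤ ∫ |w| |sinh(t/2)| = |∫ v sinh(t/2)|`).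
[folklore] -/
theorem weilPoleForm_signFold_le (hwo : ∀ x, w (-x) = -w x) :
    weilPoleForm (fun x ↦ (((Real.sign x * ‖w x‖ : ℝ)) : ℂ)) ≤ weilPoleForm w := by
  set v : ℝ → ℂ := fun x ↦ (((Real.sign x * ‖w x‖ : ℝ)) : ℂ) with hv
  have hvo : ∀ x, v (-x) = -v x := signFold_neg hwo
  rw [weilPoleForm_eq_of_odd hvo, weilPoleForm_eq_of_odd hwo]
  have h1 := norm_integral_mul_sinh_le w
  have h2 : ∫ t : ℝ, v t * (Real.sinh (t / 2) : ℂ) = ((∫ t : ℝ, ‖w t‖ * |Real.sinh (t / 2)| : ℝ) : ℂ) := by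
    rw [← integral_complex_ofReal]
    refine integral_congr_ae (Eventually.of_forall fun t ↦ ?_)
    simp only [hv, ← Complex.ofReal_mul]
    congr 1
    rcases lt_trichotomy t 0 with ht | ht | ht
    · rw [Real.sign_of_neg ht, abs_of_neg (Real.sinh_neg_iff.2 (by linarith))]; ring
    · subst ht; simp
    · rw [Real.sign_of_pos ht, abs_of_pos (Real.sinh_pos_iff.2 (by linarith))]; ring
  have h3 : ‖∫ t : ℝ, w t * (Real.sinh (t / 2) : ℂ)‖ ≤ ‖∫ t : ℝ, v t * (Real.sinh (t / 2) : ℂ)‖ := by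
    rw [h2, Complex.norm_real, Real.norm_of_nonneg (integral_nonneg fun t ↦ by positivity)]
    exact h1
  nlinarith [h3, norm_nonneg (∫ t : ℝ, w t * (Real.sinh (t / 2) : ℂ))]

end Fold

/-! ### The fold criterion -/

/-- **FOLD CRITERION** (RH-free; registered sub-goal `goodWindow_of_noOpposedReflections` of item
stmt-RiemannHypothesis-17778). If a REAL odd-sector ground state `u` at the window `a` has no
sign-opposed reflected pair — for every prime length `log n < 2a`, `Re u(s) · Re u(log n − s) ≥ 0`
for a.e. `s` with `s, log n − s ∈ (0, a)` — then the window `a` is GOOD: it carries an odd-sector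
ground state (namely `sign·|u|`) which is real and `≥ 0` a.e. on `(0, a)`. [folklore] -/
theorem goodWindow_of_noOpposedReflections :
    ∀ (a : ℝ) (u : ℝ → ℂ), IsWeilOddGroundState a u → (∀ t, (u t).im = 0) →
      (∀ n ∈ weilPrimeIndex a, ∀ᵐ s : ℝ, s ∈ Ioo 0 a → Real.log n - s ∈ Ioo 0 a →
        0 ≤ (u s).re * (u (Real.log n - s)).re) →
      ∃ v : ℝ → ℂ, IsWeilOddGroundState a v ∧
        ∀ᵐ t : ℝ, t ∈ Ioo 0 a → (v t).im = 0 ∧ 0 ≤ (v t).re := by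
  intro a u hu hreal hpairs
  have ha : 0 < a := hu.pos
  -- a good representative
  obtain ⟨w, hwm, hwo, hws, hwreal, hwu⟩ := exists_oddRepr hu hreal
  have hw : IsWeilOddGroundState a w := hu.congr_ae hwu.symm
  have hw2 : MemLp w 2 := hw.memLp
  -- the pair hypothesis for `w`
  have hpairs_w : ∀ n ∈ weilPrimeIndex a, ∀ᵐ s : ℝ, s ∈ Ioo 0 a → Real.log n - s ∈ Ioo 0 a →
      0 ≤ (w s).re * (w (Real.log n - s)).re := by
    intro n hn
    have h1 : ∀ᵐ s : ℝ, w (Real.log n - s) = u (Real.log n - s) :=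
      (Measure.measurePreserving_sub_left (volume : Measure ℝ) (Real.log n)).quasiMeasurePreserving
        |>.tendsto_ae.eventually hwu
    filter_upwards [hpairs n hn, hwu, h1] with s hs h2 h3 hs0 hs1
    rw [h2, h3]
    exact hs hs0 hs1
  -- the fold and its energy
  set v : ℝ → ℂ := fun x ↦ (((Real.sign x * ‖w x‖ : ℝ)) : ℂ) with hv
  have hv2 : MemLp v 2 := memLp_signFold hw2
  have hvo : ∀ x, v (-x) = -v x := signFold_neg hwo
  have hvs : ∀ x, x ∉ Icc (-a) a → v x = 0 := fun x hx ↦ by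
    simp only [hv, hws x hx, norm_zero, mul_zero, Complex.ofReal_zero]
  have hvn : ∫ x, ‖v x‖ ^ 2 = 1 := by rw [hv, integral_norm_sq_signFold w, hw.integral_norm_sq]
  obtain ⟨hEw, hle_w⟩ := hw.finiteEnergy
  obtain ⟨hEv, harch⟩ := archEnergy_signFold_le hwm hw2 hwo hws hEw
  have hpole := weilPoleForm_signFold_le (w := w) hwo
  have hprime : ∀ n ∈ weilPrimeIndex a,
      weilIncrement v (Real.log n) ≤ weilIncrement w (Real.log n) := by
    intro n hn
    rcases le_or_gt (Real.log n) 0 with h0 | h0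
    · -- `n ≤ 1`: `log n = 0`, both increments vanish
      have hlog : Real.log n = 0 := by
        rcases Nat.lt_or_ge n 2 with h | h
        · interval_cases n <;> simp
        · exact absurd h0 (not_le.2 (Real.log_pos (by exact_mod_cast h)))
      simp [hlog, weilIncrement]
    · exact weilIncrement_signFold_le hw2 hwo hws hwreal h0 (hpairs_w n hn)
  have hEle : weilDirichletEnergy a v ≤ weilDirichletEnergy a w := by
    unfold weilDirichletEnergy
    exact add_le_add (Finset.sum_le_sum fun n hn ↦ mul_le_mul_of_nonneg_left (hprime n hn)
      (div_nonneg ArithmeticFunction.vonMangoldt_nonneg (Real.sqrt_nonneg _))) harch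
  have hle_v : weilPoleForm v + weilDirichletEnergy a v ≤ weilMarkovConstant a + weilOddGroundEnergy a := by
    linarith
  -- conclude in the form domain
  refine ⟨v, isWeilOddGroundState_of_energy_le a v ha hv2 hvs hvo hvn hEv hle_v,
    Eventually.of_forall fun t ht ↦ ⟨?_, ?_⟩⟩
  · simp only [hv, Complex.ofReal_im]
  · simp only [hv, Complex.ofReal_re, Real.sign_of_pos ht.1, one_mul]
    exact norm_nonneg _

/-- **The fold criterion with the reflected-pair condition on the whole line** (the hypothesis in
the shape "`Re u(s) Re u(log n − s) ≥ 0` for a.e. `s ∈ (0, a)` with `log n − s ∈ (0, a)`" is what a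
position-space argument produces; this corollary takes the common stronger form "for a.e. `s` with
`0 < s < log n`", the points outside the window contributing nothing). [folklore] -/
theorem goodWindow_of_noOpposedReflections' {a : ℝ} {u : ℝ → ℂ} (hu : IsWeilOddGroundState a u)
    (hreal : ∀ t, (u t).im = 0)
    (hpairs : ∀ n ∈ weilPrimeIndex a, ∀ᵐ s : ℝ, s ∈ Ioo 0 (Real.log n) →
      0 ≤ (u s).re * (u (Real.log n - s)).re) :
    ∃ v : ℝ → ℂ, IsWeilOddGroundState a v ∧
      ∀ᵐ t : ℝ, t ∈ Ioo 0 a → (v t).im = 0 ∧ 0 ≤ (v t).re :=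
  goodWindow_of_noOpposedReflections a u hu hreal fun n hn ↦ by
    filter_upwards [hpairs n hn] with s hs hs0 hs1
    exact hs ⟨hs0.1, by linarith [hs1.1]⟩

end Summit.RiemannHypothesis.RiemannHypothesis.Theorems.OddSector

end
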